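import Summits.BirchSwinnertonDyer.Rank1Residual.WAll.AltClosersGlueSlices
import Summits.BirchSwinnertonDyer.Rank1Residual.WAll.TargetAdditiveAtThreeCells
import Summits.BirchSwinnertonDyer.Rank1Residual.WAll.TargetAdditiveAtThreePotSS
import HarnessLib

/-!
# Rung W-ALL (D-0120): row 2 AT `p = 3` at CENSUS-CELL granularity — ty-1's cell leaves
# (`TargetAdditiveAtThreeCells.lean`) FROM THE RUNG LEAVES by name, and the registry keyed to them
# (cell `bsd-wall`, lane 2, seat ty-2; glue, Theses-free)

HONEST FRAMING (cell `bsd-wall`, run/shared/lean/pub/bsd-wall/; WALL-BRIEF-v1 §2). NOTHING ASSERTED: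
no `def`, no `@[conjecture]`, no named fact, no route file imported; W-ALL is OPEN and this file
proves bookkeeping only. Seat ty-1 g4's `WAll/TargetAdditiveAtThreeCells.lean` (p505787) names the
`p = 3` slice of row 2 — the largest residue block of the wall (43 039 of 79 707 residue cells of
record, CENSUS-EXCLUSIONS v1.1) — by CENSUS CELL × RANK: `WAllExclAdd{PotMult,PotOrd,TameSS,Gss,Tprime}AtThree`
(+ `…RankZero` / `…RankOne`), `WAllExclAddWild{RankZero,RankOne}`, with the exact glue
`wAllExclAdditiveAtThree_iff_cellsAtThree` (row 2 @3 ⟺ (M)@3 ∧ (G-ord)@3 ∧ O5@3 ∧ O6). This file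
(asked: HOME/INBOX 2026-08-27T06:37:31Z, «TY-2 (optional) the cell-level version of your
`exclAdditiveAtThree_of_leaves`») supplies, pointwise at `p = 3`, the closers of
`AltClosersAdditiveCells.lean` §1 on the named cells:

* `wAllExclAddPotMultAtThree_of_lowerHalf_of_upperHalfAtThree` — **(M)@3 ⇐ LEAF K1
  `Additive.AdditiveOrdinaryLowerHalf` + the UPPER half at `3` on `SubM` (`hUpM3`, OPEN) + GZK**;
* `wAllExclAddPotOrdAtThree_of_lowerHalf_of_upperHalfAtThree` — **(G-ord)@3 ⇐ K1 + the upper half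
  at `3` on `SubGordOrd` (`hUpG3`, OPEN) + GZK**;
* `wAllExclAddGssAtThree_of_o5SharpGss` — **`(G) ∧ ss`@3 ⇐ LEAF K8 `Additive.O5SharpGss` + GZK**;
  `wAllExclAddTprimeAtThree_of_o5SharpTprime` — **`(t′)`@3 ⇐ LEAF K9t `Additive.O5SharpTprime` +
  GZK**; `wAllExclAddTameSSAtThree_of_sharpLeaves` — O5@3 ⇐ K8 + K9t + GZK;
* `wAllExclAddWildRanks_of_o6Sharp` — **O6 (both ranks) ⇐ LEAF K9w `Additive.O6Sharp` + GZK**;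
* `wAllExclAdditiveAtThree_of_cellLeavesAtThree` — row 2 @3 ⇐ K1 + `hUpM3` + `hUpG3` + K8 + K9t +
  K9w + GZK (= `exclAdditiveAtThree_of_leaves` with the upper half split along the two K1 cells, cf.
  `upperHalf_n10_iff_cells`);
* §3 (append): `wAllExclAddPotSSAtThreeRankOne_of_sharpLeaves` — ty-1 g4's block-A leaf
  `WAllExclAddPotSSAtThreeRankOne` (p506519; pot-ss at `3`, rank `1`) ⇐ K8 + K9t + K9w + GZK;
  `wAllExclAddPotSSAtThree_of_sharpLeaves` (rank `≤ 1`); `wAllExclAdditiveAtThree_of_potMult_potOrd_of_sharpLeaves`;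
* `wAllExclusions_of_cellSliceLeaves` / `wAll_of_cellSliceLeaves_primaryGZ` /
  `wAllFormula_of_cellSliceLeaves_primaryGZ` — the registry of `AltClosersGlueSlices.lean` with row
  2 read at cell granularity at `3` ((M)@3, (G-ord)@3, O5@3, O6) and by rank at `p ≥ 5`.

COUNTS: `wAll_of_cellSliceLeaves_primaryGZ` has 22 leaf / cell / slice / target / residual
hypotheses + `hW` + FIFTEEN named facts = 38 names; the only class-wide OPEN statements of row 2 that
are neither a registered leaf nor a registered slice are the two K1 upper halves at `3` INSIDE
`WAllExclAddPotMultAtThree` / `WAllExclAddPotOrdAtThree` when these are fed from the leaves. No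
census number moves; typed ≠ proved ≠ endorsed; BSD is not proved by any of this.

References: `WAll/TargetAdditiveAtThreeCells.lean` (ty-1 g4, p505787); `WAll/TargetPrimeSlices.lean`
(p503270); `WAll/AltClosersAdditiveCells.lean` §1–§2 (p496412); `WAll/AltClosersGlueSlices.lean`
(p505908); HOME/INBOX 2026-08-27T06:37:31Z; ROW2-AT3-SCOPING-v1.md; [cite: Delbourgo1998, §1.5 (G)
and Thm. 1]; [cite: Miller2011LMS, §1 and Def. 1.1].
-/

noncomputable section

open scoped Classical

open WeierstrassCurve Literature.NumberTheory.EllipticCurves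
  Literature.NumberTheory.EllipticCurves.Rank1Residual
  Literature.NumberTheory.EllipticCurves.Rank1Residual.Typed
  Literature.NumberTheory.EllipticCurves.Wuthrich2014
  Literature.NumberTheory.EllipticCurves.ModularForms

set_option autoImplicit false

namespace Summit.BirchSwinnertonDyer.Rank1Residual.WAll

open Summit.BirchSwinnertonDyer
open Summit.BirchSwinnertonDyer.BirchSwinnertonDyer.Rank1Residual (NonCMAtTwo BSDpOnClassX9)

/-! ## §1 The census cells of row 2 at `p = 3` from the registered rung leaves -/

/-- **(M)@3 ⇐ LEAF K1 + the upper half at `3` on the cell (M) + GZK** — the `p = 3` point of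
`wallExclAddPotMult_of_lowerHalf_of_upperHalf`: K1's `AdditiveOrdinaryLowerHalf` is the lower half on
`N10.Locus ⊇ (M)`, `hUpM3` the Euler-system half `MissingUpperBoundAt W 3` on `SubM` (OPEN class-wide;
in print in rank `0` on the covered locus, `upperHalfRankZero_n10_of_print_of_residual`). [folklore] -/
theorem wAllExclAddPotMultAtThree_of_lowerHalf_of_upperHalfAtThree
    (hK1 : Additive.AdditiveOrdinaryLowerHalf)
    (hUpM3 : ∀ (W : WeierstrassCurve ℚ) [W.IsElliptic] [W.IsGloballyMinimal],
      W.analyticRank ≤ 1 → Addv W 3 → Additive.SubM W 3 → MissingUpperBoundAt W 3)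
    (hGZK : rank_eq_analyticRank_of_analyticRank_le_one) : WAllExclAddPotMultAtThree :=
  fun W _ _ _ hadd hM hr ↦
    bsdp_of_missingPPartAt W 3 hGZK hr
      (missingPPartAt_of_lower_of_upper W 3 (hK1 W 3 hr ⟨by decide, hadd, Or.inl hM⟩)
        (hUpM3 W hr hadd hM))

/-- **(G-ord)@3 ⇐ LEAF K1 + the upper half at `3` on the cell (G-ord) + GZK** — the `p = 3` point
of `wallExclAddPotOrd_of_lowerHalf_of_upperHalf` (at `3` the cell (G) is entirely `e = 2`).
[cite: Delbourgo1998, §1.5 (G) and Thm. 1] -/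
theorem wAllExclAddPotOrdAtThree_of_lowerHalf_of_upperHalfAtThree
    (hK1 : Additive.AdditiveOrdinaryLowerHalf)
    (hUpG3 : ∀ (W : WeierstrassCurve ℚ) [W.IsElliptic] [W.IsGloballyMinimal],
      W.analyticRank ≤ 1 → Addv W 3 → Additive.SubGordOrd W 3 → MissingUpperBoundAt W 3)
    (hGZK : rank_eq_analyticRank_of_analyticRank_le_one) : WAllExclAddPotOrdAtThree :=
  fun W _ _ _ hadd hG hr ↦
    bsdp_of_missingPPartAt W 3 hGZK hr
      (missingPPartAt_of_lower_of_upper W 3 (hK1 W 3 hr ⟨by decide, hadd, Or.inr hG.2⟩)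
        (hUpG3 W hr hadd hG))

/-- **`(G) ∧ ss`@3 ⇐ LEAF K8 `Additive.O5SharpGss` + GZK** (the `p = 3` instance of
`wallExclAddGss_of_o5SharpGss`; BSDp twin of K8's held residual item 19120). [folklore] -/
theorem wAllExclAddGssAtThree_of_o5SharpGss (hK8 : Additive.O5SharpGss)
    (hGZK : rank_eq_analyticRank_of_analyticRank_le_one) : WAllExclAddGssAtThree :=
  wAllExclAddGssAtThree_of_gss (wallExclAddGss_of_o5SharpGss hK8 hGZK)

/-- **`(t′)`@3 ⇐ LEAF K9t `Additive.O5SharpTprime` + GZK** (the `p = 3` instance of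
`wallExclAddTprime_of_o5SharpTprime`). [folklore] -/
theorem wAllExclAddTprimeAtThree_of_o5SharpTprime (hK9t : Additive.O5SharpTprime)
    (hGZK : rank_eq_analyticRank_of_analyticRank_le_one) : WAllExclAddTprimeAtThree :=
  wAllExclAddTprimeAtThree_of_tprime (wallExclAddTprime_of_o5SharpTprime hK9t hGZK)

/-- **O5@3 ⇐ LEAVES K8 + K9t + GZK** (`wallExclAddTameSS_of_sharpLeaves` at `3`). [folklore] -/
theorem wAllExclAddTameSSAtThree_of_sharpLeaves (hK8 : Additive.O5SharpGss)
    (hK9t : Additive.O5SharpTprime) (hGZK : rank_eq_analyticRank_of_analyticRank_le_one) :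
    WAllExclAddTameSSAtThree :=
  wAllExclAddTameSSAtThree_of_tameSS (wallExclAddTameSS_of_sharpLeaves hK8 hK9t hGZK)

/-- **O6 in both ranks ⇐ LEAF K9w `Additive.O6Sharp` + GZK** (`wallExclAddWild_of_o6Sharp`, split by
`wAllExclAddWild_iff_ranks`). [folklore] -/
theorem wAllExclAddWildRanks_of_o6Sharp (hK9w : Additive.O6Sharp)
    (hGZK : rank_eq_analyticRank_of_analyticRank_le_one) :
    WAllExclAddWildRankZero ∧ WAllExclAddWildRankOne :=
  wAllExclAddWild_iff_ranks.mp (wallExclAddWild_of_o6Sharp hK9w hGZK)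

/-- **Row 2 at `3` ⇐ K1 + the two upper halves at `3` + K8 + K9t + K9w + GZK** — the cell-level
reading of `exclAdditiveAtThree_of_leaves` through ty-1's `wAllExclAdditiveAtThree_iff_cellsAtThree`.
[folklore] -/
theorem wAllExclAdditiveAtThree_of_cellLeavesAtThree (hK1 : Additive.AdditiveOrdinaryLowerHalf)
    (hUpM3 : ∀ (W : WeierstrassCurve ℚ) [W.IsElliptic] [W.IsGloballyMinimal],
      W.analyticRank ≤ 1 → Addv W 3 → Additive.SubM W 3 → MissingUpperBoundAt W 3)
    (hUpG3 : ∀ (W : WeierstrassCurve ℚ) [W.IsElliptic] [W.IsGloballyMinimal],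
      W.analyticRank ≤ 1 → Addv W 3 → Additive.SubGordOrd W 3 → MissingUpperBoundAt W 3)
    (hK8 : Additive.O5SharpGss) (hK9t : Additive.O5SharpTprime) (hK9w : Additive.O6Sharp)
    (hGZK : rank_eq_analyticRank_of_analyticRank_le_one) : WAllExclAdditiveAtThree :=
  wAllExclAdditiveAtThree_iff_cellsAtThree.mpr
    ⟨wAllExclAddPotMultAtThree_of_lowerHalf_of_upperHalfAtThree hK1 hUpM3 hGZK,
      wAllExclAddPotOrdAtThree_of_lowerHalf_of_upperHalfAtThree hK1 hUpG3 hGZK,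
      wAllExclAddTameSSAtThree_of_sharpLeaves hK8 hK9t hGZK, wallExclAddWild_of_o6Sharp hK9w hGZK⟩

/-! ## §2 The registry with row 2 at `3` read at census-cell granularity -/

/-- **THE CLOSED LIST with row 2 fed by its four CELLS at `3` and its two RANK slices at `p ≥ 5`**
(ty-1's `wAllExclAdditive_iff_cellsAtThree_fiveLe` + `wAllExclAdditiveFiveLe_iff_ranks`), every
other row as in `wAllExclusions_of_sliceLeaves`. [folklore] -/
theorem wAllExclusions_of_cellSliceLeaves (h5 : NonCMAtTwo)
    (hM3 : WAllExclAddPotMultAtThree) (hG3 : WAllExclAddPotOrdAtThree)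
    (hT3 : WAllExclAddTameSSAtThree) (hWild : WAllExclAddWild)
    (h50 : WAllExclAdditiveFiveLeRankZero) (h51 : WAllExclAdditiveFiveLeRankOne)
    (hK2a : X11b.MultiplicativeRankOne) (hK2b : X11b.MultiplicativeRankOneAtThree)
    (hK5 : Eisenstein.EisensteinPrimes) (hK3 : Supersingular.SignedSupersingular)
    (h73 : WAllCornerX7AtThree) (h75 : WAllCornerX7FiveLe)
    (hK6 : BSDpOnClassX9) (hX10b : X10.BSDpOnClassX10b) (hX11a : X11a.Target)
    (hF3 : WAllCornerFInertBadAtThree) (hF5 : WAllCornerFInertBadFiveLe)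
    (hF2 : WAllCornerFTwo) (hFr : WAllCornerFRamified)
    (hW : sha_dvd_analyticSha) (hmod : hasEntireLFunction_rat)
    (hGZK : rank_eq_analyticRank_of_analyticRank_le_one) : WAllExclusions := by
  obtain ⟨h30, h31⟩ := wAllExclAdditiveAtThree_iff_ranks.mp
    (wAllExclAdditiveAtThree_iff_cellsAtThree.mpr ⟨hM3, hG3, hT3, hWild⟩)
  exact wAllExclusions_of_sliceLeaves h5 h30 h31 h50 h51 hK2a hK2b hK5 hK3 h73 h75 hK6 hX10b hX11a hF3
    hF5 hF2 hFr hW hmod hGZK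

/-- **W-ALL with row 2 at `3` at census-cell granularity, FIFTEEN named facts, the Gross–Zagier side
primary** (`wAll_of_exclusions_primaryGZ ∘ wAllExclusions_of_cellSliceLeaves`; `hmod` derived,
`hGZK` fed from its road of record). [cite: Darmon2004, Thm. 3.22 and §3.9] -/
theorem wAll_of_cellSliceLeaves_primaryGZ (h5 : NonCMAtTwo)
    (hM3 : WAllExclAddPotMultAtThree) (hG3 : WAllExclAddPotOrdAtThree)
    (hT3 : WAllExclAddTameSSAtThree) (hWild : WAllExclAddWild)
    (h50 : WAllExclAdditiveFiveLeRankZero) (h51 : WAllExclAdditiveFiveLeRankOne)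
    (hK2a : X11b.MultiplicativeRankOne) (hK2b : X11b.MultiplicativeRankOneAtThree)
    (hK5 : Eisenstein.EisensteinPrimes) (hK3 : Supersingular.SignedSupersingular)
    (h73 : WAllCornerX7AtThree) (h75 : WAllCornerX7FiveLe)
    (hK6 : BSDpOnClassX9) (hX10b : X10.BSDpOnClassX10b) (hX11a : X11a.Target)
    (hF3 : WAllCornerFInertBadAtThree) (hF5 : WAllCornerFInertBadFiveLe)
    (hF2 : WAllCornerFTwo) (hFr : WAllCornerFRamified)
    (hW : sha_dvd_analyticSha)
    (hSk : Skinner2016.thmC_padicValRat_bsd_rank_zero)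
    (hBCS : BurungaleCastellaSkinner2025.cor131_padicValRat_bsd_rank_le_one)
    (hJSW : JetchevSkinnerWan2017.thm121_padicValRat_bsd_rank_one)
    (hCGS : CastellaGrossiSkinner2025.thmD_padicValRat_bsd_rank_le_one)
    (hGV : GreenbergVatsal2000.thm13_charIdeal_eq_of_gvPar) (hGr : greenberg_charValue_rankZero)
    (hmodP : nonempty_modularParametrizationData)
    (hWa : waldspurger_exists_heegnerField_twist_ne_zero)
    (hMM : murtyMurty_exists_heegnerField_twist_simpleZero)
    (hGZ : ∀ (N : ℕ) [NeZero N] (W : WeierstrassCurve ℚ) (K : Type) [Field K] [NumberField K],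
      gross_zagier N W K)
    (hKo : ∀ (N : ℕ) [NeZero N] (W : WeierstrassCurve ℚ) (K : Type) [Field K] [NumberField K],
      kolyvagin N W K)
    (hCM : bsdTriple_of_hasCM_of_L_one_ne_zero) (hKob : Kobayashi2013.cor14_bsdp_of_cm_rank_one)
    (hYZ : YanZhu2026.thm415_padicValRat_bsd_rank_le_one)
    (hLLT : LiLiuTian2024.thm11_bsdp_of_cm_rank_one) : WAll :=
  wAll_of_exclusions_primaryGZ
    (wAllExclusions_of_cellSliceLeaves h5 hM3 hG3 hT3 hWild h50 h51 hK2a hK2b hK5 hK3 h73 h75 hK6 hX10b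
      hX11a hF3 hF5 hF2 hFr hW
      (X2.ClassClosureEntireFree.hasEntireLFunction_rat_of_nonempty_modularParametrizationData hmodP)
      (rank_eq_analyticRank_of_analyticRank_le_one_of_nonempty_modularParametrizationData hmodP hWa
        hMM hGZ hKo))
    hSk hBCS hJSW hCGS hGV hGr hmodP hWa hMM hGZ hKo hCM hKob hYZ hLLT

/-- **THE FULL BSD FORMULA FOR EVERY `E/ℚ` OF ANALYTIC RANK `≤ 1`** with row 2 at `3` read at
census-cell granularity: FIFTEEN named facts and ONE sign binder `hL0`.
[cite: GrossZagier1986, Thm. V.(2.1) (p. 311) and V.§2 (pp. 312–313)]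
[cite: Darmon2004, Thm. 3.22 and §3.9] -/
theorem wAllFormula_of_cellSliceLeaves_primaryGZ (h5 : NonCMAtTwo)
    (hM3 : WAllExclAddPotMultAtThree) (hG3 : WAllExclAddPotOrdAtThree)
    (hT3 : WAllExclAddTameSSAtThree) (hWild : WAllExclAddWild)
    (h50 : WAllExclAdditiveFiveLeRankZero) (h51 : WAllExclAdditiveFiveLeRankOne)
    (hK2a : X11b.MultiplicativeRankOne) (hK2b : X11b.MultiplicativeRankOneAtThree)
    (hK5 : Eisenstein.EisensteinPrimes) (hK3 : Supersingular.SignedSupersingular)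
    (h73 : WAllCornerX7AtThree) (h75 : WAllCornerX7FiveLe)
    (hK6 : BSDpOnClassX9) (hX10b : X10.BSDpOnClassX10b) (hX11a : X11a.Target)
    (hF3 : WAllCornerFInertBadAtThree) (hF5 : WAllCornerFInertBadFiveLe)
    (hF2 : WAllCornerFTwo) (hFr : WAllCornerFRamified)
    (hW : sha_dvd_analyticSha)
    (hSk : Skinner2016.thmC_padicValRat_bsd_rank_zero)
    (hBCS : BurungaleCastellaSkinner2025.cor131_padicValRat_bsd_rank_le_one)
    (hJSW : JetchevSkinnerWan2017.thm121_padicValRat_bsd_rank_one)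
    (hCGS : CastellaGrossiSkinner2025.thmD_padicValRat_bsd_rank_le_one)
    (hGV : GreenbergVatsal2000.thm13_charIdeal_eq_of_gvPar) (hGr : greenberg_charValue_rankZero)
    (hmodP : nonempty_modularParametrizationData)
    (hWa : waldspurger_exists_heegnerField_twist_ne_zero)
    (hMM : murtyMurty_exists_heegnerField_twist_simpleZero)
    (hGZ : ∀ (N : ℕ) [NeZero N] (W : WeierstrassCurve ℚ) (K : Type) [Field K] [NumberField K],
      gross_zagier N W K)
    (hKo : ∀ (N : ℕ) [NeZero N] (W : WeierstrassCurve ℚ) (K : Type) [Field K] [NumberField K],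
      kolyvagin N W K)
    (hCM : bsdTriple_of_hasCM_of_L_one_ne_zero) (hKob : Kobayashi2013.cor14_bsdp_of_cm_rank_one)
    (hYZ : YanZhu2026.thm415_padicValRat_bsd_rank_le_one)
    (hLLT : LiLiuTian2024.thm11_bsdp_of_cm_rank_one)
    (hL0 : re_entireLFunction_one_nonneg) : WAllFormula :=
  wAllFormula_of_wAll_oneSign hmodP hL0 hWa hGZ
    (wAll_of_cellSliceLeaves_primaryGZ h5 hM3 hG3 hT3 hWild h50 h51 hK2a hK2b hK5 hK3 h73 h75 hK6 hX10b
      hX11a hF3 hF5 hF2 hFr hW hSk hBCS hJSW hCGS hGV hGr hmodP hWa hMM hGZ hKo hCM hKob hYZ hLLT)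

/-! ## §3 Block A of the `p = 3` scoping memo: potentially supersingular at `3`, rank one -/

/-- **`WAllExclAddPotSSAtThreeRankOne` (ty-1 g4's single leaf for ROW2-AT3 block A, p506519:
non-CM, `ClassO5 W 3 ∨ ClassO6 W 3`, `r_an = 1` ⇒ `BSD(E,3)`) ⇐ LEAVES K8 `O5SharpGss` + K9t
`O5SharpTprime` + K9w `O6Sharp` + GZK** — through its `…_of_atoms` glue (`(G) ∧ ss`@3 ∧ `(t′)`@3 in
rank `1` ∧ O6 in rank `1`). The `--closes-target` offered to the `bsd-wall-pss3` seat, from the three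
registered sharp leaves by name. [folklore] -/
theorem wAllExclAddPotSSAtThreeRankOne_of_sharpLeaves (hK8 : Additive.O5SharpGss)
    (hK9t : Additive.O5SharpTprime) (hK9w : Additive.O6Sharp)
    (hGZK : rank_eq_analyticRank_of_analyticRank_le_one) : WAllExclAddPotSSAtThreeRankOne :=
  wAllExclAddPotSSAtThreeRankOne_of_atoms (wAllExclAddGssAtThree_of_o5SharpGss hK8 hGZK)
    (wAllExclAddTprimeAtThree_iff_ranks.mp (wAllExclAddTprimeAtThree_of_o5SharpTprime hK9t hGZK)).2
    (wAllExclAddWildRanks_of_o6Sharp hK9w hGZK).2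

/-- **The rank-`≤ 1` block `WAllExclAddPotSSAtThree` ⇐ K8 + K9t + K9w + GZK** (O5@3 ∧ O6 through
`wAllExclAddPotSSAtThree_iff`). [folklore] -/
theorem wAllExclAddPotSSAtThree_of_sharpLeaves (hK8 : Additive.O5SharpGss)
    (hK9t : Additive.O5SharpTprime) (hK9w : Additive.O6Sharp)
    (hGZK : rank_eq_analyticRank_of_analyticRank_le_one) : WAllExclAddPotSSAtThree :=
  wAllExclAddPotSSAtThree_iff.mpr
    ⟨wAllExclAddTameSSAtThree_of_sharpLeaves hK8 hK9t hGZK, wallExclAddWild_of_o6Sharp hK9w hGZK⟩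

/-- **Row 2 at `3` ⇐ (M)@3 + (G-ord)@3 + the potentially-supersingular block from the sharp leaves**
(ty-1's `wAllExclAdditiveAtThree_of_potMult_potOrd_potSS` reading; the two K1 cells stay hypotheses).
[folklore] -/
theorem wAllExclAdditiveAtThree_of_potMult_potOrd_of_sharpLeaves (hM3 : WAllExclAddPotMultAtThree)
    (hG3 : WAllExclAddPotOrdAtThree) (hK8 : Additive.O5SharpGss) (hK9t : Additive.O5SharpTprime)
    (hK9w : Additive.O6Sharp) (hGZK : rank_eq_analyticRank_of_analyticRank_le_one) :
    WAllExclAdditiveAtThree :=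
  wAllExclAdditiveAtThree_iff_cellsAtThree.mpr
    ⟨hM3, hG3, wAllExclAddTameSSAtThree_of_sharpLeaves hK8 hK9t hGZK, wallExclAddWild_of_o6Sharp hK9w hGZK⟩

end Summit.BirchSwinnertonDyer.Rank1Residual.WAll

end
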